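import Literature.MathematicalPhysics.QuantumLattice.LatticeScalarFieldProofs
import Literature.MathematicalPhysics.QuantumFieldTheory.GaussianToolkit
import HarnessLib

/-!
# The lattice `φ⁴` measure as a perturbed Gaussian (Glimm–Jaffe §9.5–9.6)

Companion of `LatticeScalarField.lean` / `LatticeScalarFieldProofs.lean`. Glimm–Jaffe write the
lattice `P(φ)₂` measure as a perturbation of the lattice Gaussian measure
`dφ_{C_δ} = Z⁻¹ exp (−½ ⟨φ, C_δ⁻¹ φ⟩) ∏ₓ dφ(x)` of covariance `C_δ = (−Δ_δ + m²)⁻¹`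
(*Quantum Physics*, 2nd ed. 1987, §9.5 for `C_δ` and the lattice Laplacian `Δ_δ`, (9.5.7);
§9.6, (9.6.6) for the Gaussian measure) by the Wick-ordered interaction,
`dμ_δ = exp (−:P(φ_δ):) dφ_{C_δ} / ∫ exp (−:P(φ_δ):) dφ_{C_δ}` (§9.6, (9.6.8)). The tree pins the
lattice `φ⁴` measure instead as the exponential tilt `phi4Measure G g κ J` of Lebesgue measure
by the action `S(φ) = ∑ₓ (g φₓ⁴ + κ φₓ²) − J ∑_{xy} φₓ φ_y` (`phi4Action`). This file proves the
dictionary between the two presentations, for an arbitrary finite simple graph `G`: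

* `phi4Precision G κ J = 2κ·1 − J·A_G` (`A_G` the adjacency matrix) is the **precision matrix**
  (inverse covariance, `C_δ⁻¹` up to the lattice scaling) of the quadratic part of the action:
  `phi4Action G 0 κ J φ = ½ φᵀ P φ` (`phi4Action_zero_eq`), via
  `φᵀ A_G φ = 2 ∑_{xy ∈ E(G)} φₓ φ_y` (`dotProduct_adjMatrix_mulVec_self`);
* `posDef_phi4Precision`: `P` is positive definite as soon as `|J| Δ(G) < 2κ` (diagonal
  dominance; for the `d`-dimensional dictionary `κ = d δ^{d−2} + m² δᵈ/2`, `J = δ^{d−2}`,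
  `Δ = 2d` this is `m² > 0`);
* `phi4Measure_zero_eq_map_multivariateGaussian`: for positive definite `P`, **the `g = 0`
  lattice measure is the centred Gaussian `N(0, P⁻¹)`** (Mathlib's `multivariateGaussian`,
  transported from Euclidean `ℝ^V` to `V → ℝ` along `WithLp.ofLp`), i.e. (9.6.6); with it
  `integrable_exp_neg_phi4Action_zero` (the Gaussian partition function is finite),
  `isProbabilityMeasure_phi4Measure_zero`, and the **characteristic function**
  `∫ e^{i t·φ} dμ₀ = e^{−½ tᵀ P⁻¹ t}` (`integral_cexp_dotProduct_phi4Measure_zero`, the generating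
  function of the Gaussian measure (9.6.6), cf. (6.2.2));
* `phi4Measure_eq_tilted_zero`: **the interacting measure is the Gaussian one tilted by the
  interaction**, `phi4Measure G g κ J = (phi4Measure G 0 κ₀ J).tilted (−(g ∑ φ⁴ + (κ−κ₀) ∑ φ²))`
  for any reference mass `κ₀` with `P(κ₀, J)` positive definite — (9.6.8), the mass shift
  `κ − κ₀` carrying the Wick-ordering counterterm.

Mathlib-generic Gaussian input (density of a non-degenerate multivariate Gaussian) comes from the
tree's `QuantumFieldTheory.GaussianToolkit` (`multivariateGaussian_inv_eq_withDensity`). What is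
NOT here: the covariance itself as a lattice Green's function (`(−Δ_δ + m²)⁻¹` on the torus, its
Fourier representation and the logarithmic bound on its diagonal, §9.5), Wick powers, and any
`δ → 0` statement.

## References

* J. Glimm, A. Jaffe, *Quantum Physics. A Functional Integral Point of View*, 2nd ed., Springer
  1987, §9.5 (lattice covariance `C_δ = (−Δ_δ + m²)⁻¹`, lattice Laplacian (9.5.7)), §9.6 (the
  Gaussian measure (9.6.6), the interaction measure (9.6.8)), §6.2 ((6.2.2), generating function).
* B. Simon, *The `P(φ)₂` Euclidean (Quantum) Field Theory*, Princeton 1974, §VIII.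
-/

noncomputable section

open MeasureTheory ProbabilityTheory Matrix Finset Complex
open scoped ENNReal

namespace Literature.MathematicalPhysics.QuantumLattice

section Graph

variable {V : Type*} [Fintype V] [DecidableEq V] (G : SimpleGraph V) [DecidableRel G.Adj]

/-! ### The precision matrix of the quadratic part of the action -/

/-- The **precision matrix** (inverse covariance) of the quadratic part of the lattice `φ⁴`
action `phi4Action G g κ J`: `P = 2κ·1 − J·A_G` with `A_G` the adjacency matrix of `G`, so that
`∑ₓ κ φₓ² − J ∑_{xy ∈ E(G)} φₓ φ_y = ½ φᵀ P φ` (`phi4Action_zero_eq`). In the standard lattice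
regularisation dictionary of `phi4Action` (`κ = d δ^{d−2} + m² δᵈ/2`, `J = δ^{d−2}` on `δℤᵈ`)
this is `δᵈ (−Δ_δ + m²)` with `Δ_δ` the lattice Laplacian (9.5.7), i.e. `P⁻¹` is Glimm–Jaffe's
lattice covariance `C_δ` up to the Riemann-sum weight `δᵈ`; `½ φᵀ P φ` is the exponent of the
Gaussian measure (9.6.6). (Glimm–Jaffe 1987, §9.5, (9.5.7); §9.6, (9.6.6).) [cite: GlimmJaffe1987, §9.5 (9.5.7)] -/
def phi4Precision (κ J : ℝ) : Matrix V V ℝ :=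
  (2 * κ) • (1 : Matrix V V ℝ) - J • G.adjMatrix ℝ

omit [Fintype V] in
/-- The precision matrix is symmetric. (Glimm–Jaffe 1987, §9.5.) [folklore] -/
theorem phi4Precision_transpose (κ J : ℝ) : (phi4Precision G κ J)ᵀ = phi4Precision G κ J := by
  simp [phi4Precision, Matrix.transpose_sub, Matrix.transpose_smul, SimpleGraph.transpose_adjMatrix]

omit [Fintype V] in
/-- The precision matrix is Hermitian (real symmetric). (Glimm–Jaffe 1987, §9.5.) [folklore] -/
theorem isHermitian_phi4Precision (κ J : ℝ) : (phi4Precision G κ J).IsHermitian := by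
  rw [Matrix.IsHermitian, Matrix.conjTranspose_eq_transpose_of_trivial, phi4Precision_transpose]

/-- `P φ = 2κ φ − J A_G φ`. [folklore] -/
theorem phi4Precision_mulVec (κ J : ℝ) (φ : V → ℝ) :
    phi4Precision G κ J *ᵥ φ = (2 * κ) • φ - J • (G.adjMatrix ℝ *ᵥ φ) := by
  rw [phi4Precision, Matrix.sub_mulVec, Matrix.smul_mulVec, Matrix.smul_mulVec, Matrix.one_mulVec]

omit [DecidableEq V] in
/-- **Ordered versus unordered pairs**: the double sum of `φᵢ ψⱼ + φⱼ ψᵢ`-symmetric weights over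
ordered adjacent pairs is twice the sum over edges; here for the quadratic weight,
`∑ᵢ ∑ⱼ [i ∼ j] φᵢ φⱼ = 2 ∑_{e ∈ E(G)} φ(e)` with `φ({x,y}) = φₓ φ_y` (`pairInteraction`).
[folklore] -/
theorem sum_sum_adj_mul_eq_two_mul_pairInteraction (φ : V → ℝ) :
    (∑ i, ∑ j, if G.Adj i j then φ i * φ j else 0) = 2 * pairInteraction G φ := by
  classical
  -- as a sum over the finset `F` of ordered adjacent pairs, through the quotient map `q`
  set F : Finset (V × V) := univ.filter fun p : V × V => G.Adj p.1 p.2 with hF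
  set q : V × V → Sym2 V := fun p => s(p.1, p.2) with hq
  set w : Sym2 V → ℝ := Sym2.lift ⟨fun x y => φ x * φ y, fun _ _ => mul_comm _ _⟩ with hw
  have hwq : ∀ p : V × V, w (q p) = φ p.1 * φ p.2 := fun p => by
    simp only [hw, hq, Sym2.lift_mk]
  have h1 : (∑ i, ∑ j, if G.Adj i j then φ i * φ j else 0) = ∑ p ∈ F, w (q p) := by
    rw [hF, Finset.sum_filter, ← Finset.univ_product_univ, Finset.sum_product]
    simp only [hwq]
  -- the image of `F` under `q` is the edge set, with fibres of size two
  have himage : F.image q = G.edgeFinset := by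
    ext e
    induction e using Sym2.ind with
    | h x y =>
      simp only [hF, hq, Finset.mem_image, Finset.mem_filter, Finset.mem_univ, true_and,
        SimpleGraph.mem_edgeFinset, SimpleGraph.mem_edgeSet, Prod.exists, Sym2.eq_iff]
      constructor
      · rintro ⟨a, b, hab, ⟨rfl, rfl⟩ | ⟨rfl, rfl⟩⟩
        · exact hab
        · exact hab.symm
      · intro h
        exact ⟨x, y, h, Or.inl ⟨rfl, rfl⟩⟩
  have hfib : ∀ e ∈ F.image q, (F.filter fun p => q p = e).card = 2 := by
    intro e he
    rw [himage] at he
    induction e using Sym2.ind with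
    | h x y =>
      have hxy : G.Adj x y := by simpa using he
      have hne : x ≠ y := hxy.ne
      have hset : (F.filter fun p => q p = s(x, y)) = {(x, y), (y, x)} := by
        ext ⟨a, b⟩
        simp only [hF, hq, Finset.mem_filter, Finset.mem_univ, true_and, Finset.mem_insert,
          Finset.mem_singleton, Sym2.eq_iff, Prod.mk.injEq]
        constructor
        · rintro ⟨-, h | h⟩
          · exact Or.inl h
          · exact Or.inr h
        · rintro (⟨rfl, rfl⟩ | ⟨rfl, rfl⟩)
          · exact ⟨hxy, Or.inl ⟨rfl, rfl⟩⟩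
          · exact ⟨hxy.symm, Or.inr ⟨rfl, rfl⟩⟩
      rw [hset, Finset.card_insert_of_notMem, Finset.card_singleton]
      simp only [Finset.mem_singleton, Prod.mk.injEq, not_and]
      exact fun h => absurd h hne
  rw [h1, Finset.sum_comp, Finset.sum_congr rfl fun e he => by rw [hfib e he], himage,
    ← Finset.smul_sum]
  simp only [pairInteraction, hw, nsmul_eq_mul, Nat.cast_ofNat]

omit [DecidableEq V] in
/-- The adjacency quadratic form is twice the pair interaction: `φᵀ A_G φ = 2 ∑_{xy} φₓ φ_y`.
(Glimm–Jaffe 1987, §9.5.) [folklore] -/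
theorem dotProduct_adjMatrix_mulVec_self (φ : V → ℝ) :
    φ ⬝ᵥ G.adjMatrix ℝ *ᵥ φ = 2 * pairInteraction G φ := by
  rw [SimpleGraph.dotProduct_mulVec_adjMatrix]
  exact sum_sum_adj_mul_eq_two_mul_pairInteraction G φ

/-- The precision quadratic form: `φᵀ P φ = 2 (κ ∑ₓ φₓ² − J ∑_{xy} φₓ φ_y)`.
(Glimm–Jaffe 1987, §9.5.) [folklore] -/
theorem dotProduct_phi4Precision_mulVec_self (κ J : ℝ) (φ : V → ℝ) :
    φ ⬝ᵥ phi4Precision G κ J *ᵥ φ = 2 * (κ * ∑ x, φ x ^ 2 - J * pairInteraction G φ) := by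
  rw [phi4Precision_mulVec, dotProduct_sub, dotProduct_smul, dotProduct_smul,
    dotProduct_adjMatrix_mulVec_self]
  have h : φ ⬝ᵥ φ = ∑ x, φ x ^ 2 := by simp [dotProduct, sq]
  rw [h]
  simp only [smul_eq_mul]
  ring

/-- **The quadratic part of the action is `½ φᵀ P φ`**:
`phi4Action G 0 κ J φ = ∑ₓ κ φₓ² − J ∑_{xy} φₓ φ_y = ½ φᵀ (2κ·1 − J·A_G) φ`.
(Glimm–Jaffe 1987, §9.6, the exponent of (9.6.6).) [cite: GlimmJaffe1987, §9.6 (9.6.6)] -/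
theorem phi4Action_zero_eq (κ J : ℝ) (φ : V → ℝ) :
    phi4Action G 0 κ J φ = (φ ⬝ᵥ phi4Precision G κ J *ᵥ φ) / 2 := by
  rw [dotProduct_phi4Precision_mulVec_self]
  simp only [phi4Action, zero_mul, zero_add, ← Finset.mul_sum]
  ring

omit [DecidableEq V] in
/-- The action splits as interaction plus a reference quadratic part:
`S_{g,κ,J}(φ) = (g ∑ₓ φₓ⁴ + (κ − κ₀) ∑ₓ φₓ²) + S_{0,κ₀,J}(φ)`. (Glimm–Jaffe 1987, §9.6, (9.6.8):
interaction + Gaussian exponent, the mass shift `κ − κ₀` being the Wick counterterm.)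
[folklore] -/
theorem phi4Action_eq_interaction_add_zero (g κ κ₀ J : ℝ) (φ : V → ℝ) :
    phi4Action G g κ J φ =
      (g * ∑ x, φ x ^ 4 + (κ - κ₀) * ∑ x, φ x ^ 2) + phi4Action G 0 κ₀ J φ := by
  simp only [phi4Action, zero_mul, zero_add, Finset.sum_add_distrib, ← Finset.mul_sum]
  ring

/-! ### Positive definiteness by diagonal dominance -/

omit [DecidableEq V] in
/-- The adjacency quadratic form is bounded by the maximal degree:
`|φᵀ A_G φ| ≤ Δ ∑ₓ φₓ²` whenever every vertex has degree at most `Δ`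
(from `|φᵢ φⱼ| ≤ ½(φᵢ² + φⱼ²)`). [folklore] -/
theorem abs_dotProduct_adjMatrix_mulVec_self_le {Δ : ℕ} (hΔ : ∀ v, G.degree v ≤ Δ)
    (φ : V → ℝ) : |φ ⬝ᵥ G.adjMatrix ℝ *ᵥ φ| ≤ Δ * ∑ x, φ x ^ 2 := by
  rw [SimpleGraph.dotProduct_mulVec_adjMatrix]
  -- row sums and column sums of the adjacency pattern are degrees
  have hdeg : ∀ ψ : V → ℝ, (∑ i, ∑ j, if G.Adj i j then ψ i else 0) =
      ∑ i, (G.degree i : ℝ) * ψ i := by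
    intro ψ
    refine Finset.sum_congr rfl fun i _ => ?_
    rw [← Finset.sum_filter, ← SimpleGraph.neighborFinset_eq_filter, Finset.sum_const,
      SimpleGraph.card_neighborFinset_eq_degree, nsmul_eq_mul]
  have hdeg' : ∀ ψ : V → ℝ, (∑ i, ∑ j, if G.Adj i j then ψ j else 0) =
      ∑ j, (G.degree j : ℝ) * ψ j := by
    intro ψ
    rw [Finset.sum_comm]
    refine Finset.sum_congr rfl fun j _ => ?_
    have hfilter : (univ.filter fun i => G.Adj i j) = G.neighborFinset j := by
      ext i
      simp only [Finset.mem_filter, Finset.mem_univ, true_and, SimpleGraph.mem_neighborFinset]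
      exact ⟨fun h => h.symm, fun h => h.symm⟩
    rw [← Finset.sum_filter, hfilter, Finset.sum_const, SimpleGraph.card_neighborFinset_eq_degree,
      nsmul_eq_mul]
  -- `|φᵢ φⱼ| ≤ ½(φᵢ² + φⱼ²)` termwise
  have hpt : ∀ i j, |(if G.Adj i j then φ i * φ j else 0)| ≤
      (if G.Adj i j then φ i ^ 2 else 0) / 2 + (if G.Adj i j then φ j ^ 2 else 0) / 2 := by
    intro i j
    split_ifs
    · rw [abs_le]
      constructor <;> nlinarith [sq_nonneg (φ i + φ j), sq_nonneg (φ i - φ j)]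
    · simp
  calc |∑ i, ∑ j, (if G.Adj i j then φ i * φ j else 0)|
      ≤ ∑ i, ∑ j, |(if G.Adj i j then φ i * φ j else 0)| :=
        (Finset.abs_sum_le_sum_abs _ _).trans
          (Finset.sum_le_sum fun i _ => Finset.abs_sum_le_sum_abs _ _)
    _ ≤ ∑ i, ∑ j, ((if G.Adj i j then φ i ^ 2 else 0) / 2 +
          (if G.Adj i j then φ j ^ 2 else 0) / 2) :=
        Finset.sum_le_sum fun i _ => Finset.sum_le_sum fun j _ => hpt i j
    _ = (∑ i, (G.degree i : ℝ) * φ i ^ 2) / 2 + (∑ j, (G.degree j : ℝ) * φ j ^ 2) / 2 := by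
        simp only [Finset.sum_add_distrib, ← Finset.sum_div, hdeg, hdeg']
    _ = ∑ i, (G.degree i : ℝ) * φ i ^ 2 := by ring
    _ ≤ ∑ i, (Δ : ℝ) * φ i ^ 2 := Finset.sum_le_sum fun i _ =>
        mul_le_mul_of_nonneg_right (by exact_mod_cast hΔ i) (sq_nonneg _)
    _ = Δ * ∑ x, φ x ^ 2 := by rw [Finset.mul_sum]

/-- **Diagonal dominance**: if every vertex of `G` has degree at most `Δ` and `|J| Δ < 2κ`, the
precision matrix `2κ·1 − J·A_G` is positive definite (`φᵀ P φ ≥ (2κ − |J| Δ) ∑ φₓ²`). For the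
lattice dictionary of `phi4Action` on `δℤᵈ` or its tori (`Δ = 2d`, `κ = d δ^{d−2} + m² δᵈ/2`,
`J = δ^{d−2}`) the hypothesis reads `m² δᵈ > 0`. (Glimm–Jaffe 1987, §9.5: `C_δ⁻¹ = −Δ_δ + m² > 0`.)
[folklore] -/
theorem posDef_phi4Precision {κ J : ℝ} {Δ : ℕ} (hΔ : ∀ v, G.degree v ≤ Δ)
    (hκ : |J| * Δ < 2 * κ) : (phi4Precision G κ J).PosDef := by
  refine Matrix.PosDef.of_dotProduct_mulVec_pos (isHermitian_phi4Precision G κ J) fun x hx => ?_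
  rw [star_trivial, dotProduct_phi4Precision_mulVec_self]
  have hsq : 0 < ∑ v, x v ^ 2 := by
    obtain ⟨v, hv⟩ := Function.ne_iff.1 hx
    exact lt_of_lt_of_le (sq_pos_iff.2 hv)
      (Finset.single_le_sum (fun w _ => sq_nonneg (x w)) (Finset.mem_univ v))
  have hpair : |J * pairInteraction G x| ≤ |J| * Δ * (∑ v, x v ^ 2) / 2 := by
    rw [abs_mul]
    have h := abs_dotProduct_adjMatrix_mulVec_self_le G hΔ x
    rw [dotProduct_adjMatrix_mulVec_self, abs_mul, abs_two] at h
    nlinarith [abs_nonneg J, abs_nonneg (pairInteraction G x)]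
  have h1 := le_abs_self (J * pairInteraction G x)
  nlinarith [mul_pos (sub_pos.2 hκ) hsq]

/-! ### The `g = 0` measure is the Gaussian `N(0, P⁻¹)` -/

open Literature.MathematicalPhysics.QuantumFieldTheory in
/-- The Gaussian weight of `GaussianToolkit` along `toLp` is `exp (−S₀)`:
`w_P(φ) = e^{−½ φᵀ P φ} = e^{−phi4Action G 0 κ J φ}`. [folklore] -/
theorem gaussWeight_phi4Precision_toLp (κ J : ℝ) (φ : V → ℝ) :
    GaussianToolkit.gaussWeight (phi4Precision G κ J) (WithLp.toLp 2 φ) =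
      ENNReal.ofReal (Real.exp (-phi4Action G 0 κ J φ)) := by
  rw [GaussianToolkit.gaussWeight, WithLp.ofLp_toLp, phi4Action_zero_eq, neg_div]

open Literature.MathematicalPhysics.QuantumFieldTheory in
/-- The Gaussian partition function of `GaussianToolkit` is the Lebesgue integral of `exp (−S₀)`
over `V → ℝ`: `Z_P = ∫⁻ e^{−phi4Action G 0 κ J}`. [folklore] -/
theorem gaussZ_phi4Precision_eq_lintegral (κ J : ℝ) :
    GaussianToolkit.gaussZ (phi4Precision G κ J) =
      ∫⁻ φ : V → ℝ, ENNReal.ofReal (Real.exp (-phi4Action G 0 κ J φ)) := by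
  rw [GaussianToolkit.gaussZ, ← (PiLp.volume_preserving_toLp V).lintegral_comp
    (GaussianToolkit.measurable_gaussWeight _)]
  simp_rw [gaussWeight_phi4Precision_toLp]

open Literature.MathematicalPhysics.QuantumFieldTheory in
/-- **The Gaussian partition function is finite**: for positive definite `P = 2κ·1 − J·A_G`,
`φ ↦ exp (−phi4Action G 0 κ J φ) = e^{−½ φᵀPφ}` is Lebesgue integrable on `V → ℝ`.
(Glimm–Jaffe 1987, §9.6, normalisation of (9.6.6).) [cite: GlimmJaffe1987, §9.6 (9.6.6)] -/
theorem integrable_exp_neg_phi4Action_zero {κ J : ℝ} (hP : (phi4Precision G κ J).PosDef) :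
    Integrable (fun φ : V → ℝ => Real.exp (-phi4Action G 0 κ J φ)) := by
  have hZ := (GaussianToolkit.multivariateGaussian_inv_eq_withDensity hP).2.2
  rw [gaussZ_phi4Precision_eq_lintegral] at hZ
  exact (lintegral_ofReal_ne_top_iff_integrable
    (by fun_prop : Measurable fun φ : V → ℝ => Real.exp (-phi4Action G 0 κ J φ)).aestronglyMeasurable
    (Filter.Eventually.of_forall fun φ => (Real.exp_pos _).le)).1 hZ

open Literature.MathematicalPhysics.QuantumFieldTheory in
/-- **The quadratic lattice measure is Gaussian** (Glimm–Jaffe 1987, §9.6, (9.6.6):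
`dφ_C = Z⁻¹ e^{−½⟨φ, C⁻¹ φ⟩} ∏ₓ dφ(x)` *is* the Gaussian measure of covariance `C`): for positive
definite `P = 2κ·1 − J·A_G`, the `g = 0` lattice measure `phi4Measure G 0 κ J` — the tilt of
Lebesgue measure on `V → ℝ` by `−S₀ = −½ φᵀPφ` — is Mathlib's centred multivariate Gaussian
`N(0, P⁻¹)` on Euclidean `ℝ^V`, transported to `V → ℝ` along `WithLp.ofLp`.
[cite: GlimmJaffe1987, §9.6 (9.6.6)] -/
theorem phi4Measure_zero_eq_map_multivariateGaussian {κ J : ℝ}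
    (hP : (phi4Precision G κ J).PosDef) :
    phi4Measure G 0 κ J =
      (multivariateGaussian 0 (phi4Precision G κ J)⁻¹).map (WithLp.ofLp : EuclideanSpace ℝ V → V → ℝ) := by
  set P := phi4Precision G κ J with hPdef
  obtain ⟨hρ, hZ0, hZtop⟩ := GaussianToolkit.multivariateGaussian_inv_eq_withDensity hP
  -- transport the density presentation of `N(0, P⁻¹)` to `V → ℝ`
  have hmap : ((volume : Measure (EuclideanSpace ℝ V)).withDensity
      (GaussianToolkit.gaussWeight P)).map (WithLp.ofLp : EuclideanSpace ℝ V → V → ℝ) =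
      (volume : Measure (V → ℝ)).withDensity
        fun φ => ENNReal.ofReal (Real.exp (-phi4Action G 0 κ J φ)) := by
    have h := GaussianToolkit.map_withDensity_equiv (MeasurableEquiv.toLp 2 (V → ℝ)).symm
      (volume : Measure (EuclideanSpace ℝ V)) (GaussianToolkit.gaussWeight P)
    rw [MeasurableEquiv.coe_toLp_symm, (PiLp.volume_preserving_ofLp V).map_eq] at h
    rw [h]
    congr 1
    funext φ
    simp only [Function.comp_apply, MeasurableEquiv.symm_symm, MeasurableEquiv.toLp_apply]
    exact gaussWeight_phi4Precision_toLp G κ J φ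
  rw [hρ, Measure.map_smul, hmap]
  -- the tilt: density `exp (−S₀ φ) / Z` with `Z = ∫ exp (−S₀)`, and `ofReal Z = gaussZ P`
  have hint := integrable_exp_neg_phi4Action_zero G hP
  have hZ : ENNReal.ofReal (∫ φ : V → ℝ, Real.exp (-phi4Action G 0 κ J φ)) =
      GaussianToolkit.gaussZ P := by
    rw [ofReal_integral_eq_lintegral_ofReal hint
      (Filter.Eventually.of_forall fun φ => (Real.exp_pos _).le), gaussZ_phi4Precision_eq_lintegral]
  have hZpos : 0 < ∫ φ : V → ℝ, Real.exp (-phi4Action G 0 κ J φ) := by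
    have h0 : 0 ≤ ∫ φ : V → ℝ, Real.exp (-phi4Action G 0 κ J φ) :=
      integral_nonneg fun φ => (Real.exp_pos _).le
    rcases h0.lt_or_eq with h | h
    · exact h
    · exact absurd (show GaussianToolkit.gaussZ P = 0 by
        rw [← hZ, ← h, ENNReal.ofReal_zero]) hZ0
  unfold phi4Measure Measure.tilted
  rw [← withDensity_smul _ (by fun_prop)]
  congr 1
  funext φ
  rw [Pi.smul_apply, smul_eq_mul, ENNReal.ofReal_div_of_pos hZpos, hZ, ENNReal.div_eq_inv_mul]

/-- For positive definite `P` the `g = 0` lattice measure is a probability measure (it is the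
Gaussian `N(0, P⁻¹)`; compare `isProbabilityMeasure_phi4Measure_holds`, which needs `0 < g`).
(Glimm–Jaffe 1987, §9.6, (9.6.6).) [cite: GlimmJaffe1987, §9.6 (9.6.6)] -/
theorem isProbabilityMeasure_phi4Measure_zero {κ J : ℝ} (hP : (phi4Precision G κ J).PosDef) :
    IsProbabilityMeasure (phi4Measure G 0 κ J) := by
  rw [phi4Measure_zero_eq_map_multivariateGaussian G hP]
  exact Measure.isProbabilityMeasure_map (WithLp.measurable_ofLp 2 _).aemeasurable

/-- **Characteristic function of the lattice Gaussian** (the generating function of the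
Gaussian measure (9.6.6), Glimm–Jaffe 1987, §9.6, cf. (6.2.2)): for positive definite
`P = 2κ·1 − J·A_G` and every `t : V → ℝ`, `∫ exp (i t·φ) dμ_{0,κ,J}(φ) = exp (−½ tᵀ P⁻¹ t)` —
the `g = 0` lattice field is the centred Gaussian field of covariance `P⁻¹`.
[cite: GlimmJaffe1987, §9.6 (9.6.6)] -/
theorem integral_cexp_dotProduct_phi4Measure_zero {κ J : ℝ}
    (hP : (phi4Precision G κ J).PosDef) (t : V → ℝ) :
    ∫ φ, cexp (((t ⬝ᵥ φ : ℝ) : ℂ) * I) ∂(phi4Measure G 0 κ J) =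
      cexp (-((((t ⬝ᵥ (phi4Precision G κ J)⁻¹ *ᵥ t : ℝ) : ℂ)) / 2)) := by
  rw [phi4Measure_zero_eq_map_multivariateGaussian G hP,
    integral_map (WithLp.measurable_ofLp 2 _).aemeasurable (by fun_prop)]
  have h := charFun_multivariateGaussian (μ := 0) hP.inv.posSemidef (WithLp.toLp 2 t)
  rw [charFun_apply] at h
  simp only [inner_zero_right, Complex.ofReal_zero, zero_mul, zero_sub] at h
  rw [← h]
  refine integral_congr_ae (Filter.Eventually.of_forall fun y => ?_)
  simp only [EuclideanSpace.inner_eq_star_dotProduct, star_trivial]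

/-! ### The interacting measure as a tilt of the Gaussian one -/

/-- **The lattice `φ⁴` measure is the Gaussian measure tilted by the interaction**
(Glimm–Jaffe 1987, §9.6, (9.6.8): `dμ_δ = e^{−:P(φ_δ):} dφ_{C_δ} / ∫ e^{−:P(φ_δ):} dφ_{C_δ}`): for
any reference quadratic coupling `κ₀` with `P(κ₀, J) = 2κ₀·1 − J·A_G` positive definite and all
`g, κ`,
`phi4Measure G g κ J = (phi4Measure G 0 κ₀ J).tilted (φ ↦ −(g ∑ₓ φₓ⁴ + (κ − κ₀) ∑ₓ φₓ²))`,
the mass shift `κ − κ₀` carrying in particular the Wick-ordering counterterm of `:φ⁴:`. (Both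
sides are the zero measure when `exp` of the total exponent is not integrable, e.g. `g < 0`.)
[cite: GlimmJaffe1987, §9.6 (9.6.8)] -/
theorem phi4Measure_eq_tilted_zero (g κ J : ℝ) {κ₀ : ℝ}
    (hP : (phi4Precision G κ₀ J).PosDef) :
    phi4Measure G g κ J = (phi4Measure G 0 κ₀ J).tilted
      fun φ => -(g * ∑ x, φ x ^ 4 + (κ - κ₀) * ∑ x, φ x ^ 2) := by
  unfold phi4Measure
  rw [tilted_tilted (integrable_exp_neg_phi4Action_zero G hP)]
  congr 1
  funext φ
  rw [Pi.add_apply, phi4Action_eq_interaction_add_zero G g κ κ₀ J φ]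
  ring

end Graph

end Literature.MathematicalPhysics.QuantumLattice
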